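import Literature.NumberTheory.EllipticCurves.KellerYin2024.MultiplicativeReduction
import HarnessLib

/-!
# Keller–Yin (arXiv:2402.12781v2) §5.1, Lemma 5.1.1: `μ(𝔛^S_f) = 0` for the `S`-IMPRIMITIVE
# unramified Selmer dual at an odd Eisenstein prime `p ‖ N` of MULTIPLICATIVE reduction — the
# elliptic-curve / weight-2 member, as an explicitly labelled OPEN hypothesis (UNREFEREED PREPRINT)

HONEST FRAMING (cell `bsd-eis`, run/shared/lean/pub/bsd-eis/, seat `bsd-line-x2-p2` gen 3 — crux 4
`BSDpOnCellC` line b1; the cross-ladder literature-typing discipline D-0088(4): typed ≠ proved ≠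
endorsed). T. Keller, M. Yin, *On the anticyclotomic Iwasawa theory of newforms at Eisenstein primes of
semistable reduction*, arXiv:2402.12781v2 (2024-10-30) is an UNREFEREED PREPRINT. Nothing in this file
is a theorem about elliptic curves: the one `def … : Prop` below TRANSCRIBES, for an elliptic curve
over `ℚ` (`k = 2`, `ℤ[f] = ℤ`, `𝒪 = ℤ_p`, `Λ = ℤ_p⟦T⟧`), the member-`f` half of §5.1 **Lemma 5.1.1**
(arXiv v1: Lemma 5.0.2), with the suffix `_OPEN` and the tag `[claim: KellerYin2024, status:
under-review]` (D-0012), to be taken as an explicit hypothesis `(h : KellerYin2024.…_OPEN)`. Companion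
(same section, same standing hypotheses, same transcription):
`thmD_imcMult_exists_isBDPLFunction_isTorsion_charIdeal_eq_OPEN` (Thm. D = Thm. 5.1.3,
`MultiplicativeReduction.lean`), whose flag `KYD-tors` ("`Module.IsTorsion` … implicit in print;
Lemma 5.1.1 / Thm. 1.4.1 give `μ = 0` hence torsion for `𝔛^S_f ⊇ 𝔛_f`") this file makes citable by name.

## The source, verbatim (v2 TeX of record `run/shared/lean/pub/bsd-eis/lit/src/ky24-v2/main.tex`)

* §5 standing (L1718–1722): "Let `f ∈ S_2(Γ_0(N))` be a newform of weight `2` … `p ≠ 2` … `Λ =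
  𝒪⟦T⟧` and `Λ^nr = Λ ⊗̂ ℤ_p^nr`. Let `ρ̄_f` be the residual representation attached to `f` and assume
  `ρ̄_f` is reducible. Then there are characters `φ, ψ` such that there is an exact sequence
  `0 → 𝔽(φ) → ρ̄_f → 𝔽(ψ) → 0` (`badextension`). Further assume that `p ‖ N`, so `f` has bad
  multiplicative reduction at `p`." §0.1 (L233–L235): `K` a Heegner field for `N` (all primes dividing
  `N` split in `K`), `D_K` odd and `≠ −3`, `p = v v̄` splits in `K`; `Γ = Gal(K_∞/K)` THE
  anticyclotomic `ℤ_p`-extension.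
* §5.1 (L1725–1735): "As in the good reduction case, define the unramified Selmer group for `f` by
  `H¹_{𝓕_nr}(K, M_f) = ker{H¹(K^Σ/K, M_f) → ∏_{w∈Σ, w∤p} H¹(I_w, M_f)^{G_w/I_w} × H¹(I_v̄, M_f)^{G_v̄/I_v̄}}`.
  For a finite set `Σ` of places of `K` which contains `∞` and the primes above divisors of `N`, and
  such that the finite places in `Σ` are all split in `K`, let `S = Σ ∖ {v, v̄, ∞}` and define the
  `S`-imprimitive Selmer group for `f` by `H¹_{𝓕^S_nr}(K, M_f) = ker{H¹(K^Σ/K, M_f) →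
  H¹(I_v̄, M_f)^{G_v̄/I_v̄}}`. Let `𝔛_f := H¹_{𝓕_nr}(K, M_f)^∨` and `𝔛^S_f := H¹_{𝓕^S_nr}(K, M_f)^∨`."
* **Lemma 5.1.1** (L1744–1749): "The `μ`-invariants of `𝔛^S_f` and `𝔛^S_{f_m}` are `0`." Printed
  proof: "This is essentially proved in Theorem 1.4.1 [`imprimlambda`] since the proof only relies on
  the extension (`badextension`). Note that the characters can be arbitrary." (`f_m` = the good
  ordinary Hida-family members of weight `k_m > 2`, §5.1 (a).)
* Paper-wide convention, §1.4 (L1078–1083): "we could always assume that `H⁰(K^Σ/K, M_f) = 0`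
  (equivalently, `H⁰(K, ρ̄_f) = 0`), i.e., there is no global torsion for `f` … We will do so in the
  rest of this paper", achieved "by essentially choosing a lattice `T_f`" ([BP19, Thm. 5.2]); and
  §1.4 (L1070–1074): the anticyclotomic main conjecture "is independent of the lattice `T_f`"
  (Perrin-Riou's formula, [Kobayashi–Ota, Prop. 2.9]).

## Transcription (tree vocabulary only; nothing re-declared) and flags

Binder for binder the layout of the companion `thmD_imcMult_…_OPEN` (same §5 setting), minus the
newform/embedding data (`f`, `ι'`, `v`) that a statement about `𝔛^S_f` alone does not need:
* `f` weight `2`, `ℤ[f] = ℤ` — `W/ℚ` globally minimal elliptic (`f = f_W`, `N = N_W =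
  W.conductorNorm ℤ`); "`p ≠ 2` … multiplicative" — `2 < p`, `Mult W p`; "`ρ̄_f` reducible" — `Red W p`.
  `K` — `IsImaginaryQuadratic K`, (Heeg) `SatisfiesHeegnerHypothesis (W.conductorNorm ℤ) K`, (disc)
  `Odd (discr K)`, `discr K ≠ -3`, (spl) `((p)).primesOver (𝓞 K)).ncard = 2`; `vbar ∋ p` the prime
  at which `𝔛^S_f` is unramified (tree: strict), the other prime `v` over `p` being the relaxed one;
  `κ` THE anticyclotomic `ℤ_p`-extension with topological generator `γ`, `Λ = IwasawaAlgebra p`.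
* `S` — KY's `S = Σ ∖ {v, v̄, ∞}` at the MINIMAL admissible `Σ = {∞} ∪ {w ∣ N}` (admissible because
  every `w ∣ N` is split in `K` by (Heeg)), i.e. `Sf` = the places of `K` over `N_W` NOT over `p`
  (`w ∈ Sf ↔ N_W ∈ w ∧ p ∉ w`). FLAG `KY511-S`: the printed lemma holds for every admissible `Σ`; only
  the minimal one is transcribed.
* `𝔛^S_f` — `AcSelmer.XAc (W.baseChange K) p κ vbar ↑Sf γ`, Castella 2018 Def. 2.2's
  `X_ac^Σ(E[p^∞])` (strict at `v̄`, relaxed at `v`, NO condition at `w ∈ Σ = Sf`, trivial at the other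
  `w ∤ p`) — the cell's convention for Keller–Yin's `𝓕_nr`-duals (FLAG `KYD-Sel` of the companion,
  verbatim: KY identify the Greenberg and unramified objects' characteristic ideals in the good-`p`
  sections, L1633–1634 / L1704–1706; at `p ‖ N` the identification is a transcription step; likewise
  `thm141_imprimlambda_goodLattice_OPEN` for `𝔛^S_f` at good `p`).
* "`μ`-invariant `0`" — `Module.IsTorsion Λ 𝔛^S ∧ muInvariant p 𝔛^S = 0`: torsion is how the paper
  itself prints the same claim in Thm. 1.4.1 ("`Λ`-torsion with `μ`-invariants `0`"), and `Char(𝔛^S_f)`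
  is used two lines later (Lemma 5.1.2); FLAG `KY511-tors` (= `KYD-tors`). Finite generation is NOT a
  conjunct: it is Castella's theorem in the tree (`AcSelmer.XAc.module_finite`).
* FLAG `KY511-h1`: like Theorem D's transcription (cell sheet FAITHFULNESS-05: "no (Sel), no (h1), no
  lattice normalisation — none printed"), the statement carries §5's PRINTED hypotheses only; the
  paper-wide "no global torsion" convention of §1.4 is a lattice choice which, for an elliptic curve
  (`T_f = T_pE` fixed), is replaced by KY's asserted lattice-independence of the anticyclotomic main
  conjecture (L1070–1074) — part of the claim as transcribed, not of the tree.
* Only the member `f` itself is transcribed: the Hida-family members `f_m` (§5.1 (a), weight `k_m > 2`,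
  good ordinary) have no Literature object (`IsBDPLFunction` is weight-2; no weight-`k` lattices).
-- TODO(general form): Lemma 5.1.1 for every admissible `Σ ⊇ {∞} ∪ {w ∣ N}` (finite, split places),
-- for the members `f_m` of the Hida family, and for weight-2 `f` with arbitrary `ℤ[f]` (`Λ = 𝒪⟦T⟧`).

NOT A DUPLICATE: `lean search` for "5.1.1" / "lemma511" / "Lemma 5.0.2" in `Literature/…/KellerYin2024/`
returns only the companion's module docstring (locator mentions); the good-`p` analogue
`thm141_imprimlambda_goodLattice_OPEN` (Thm. 1.4.1, `Good W p`, `Anom W p`, residual-pair data) is a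
different statement (different reduction type, `λ`-relation included, character duals as binders).

## Contents (namespace `Literature.NumberTheory.EllipticCurves.KellerYin2024`)

* `lemma511_imprimitive_isTorsion_muInvariant_eq_zero_mult_OPEN` — Lemma 5.1.1, member `f` (ONE new
  `Prop`, statement only; D-0026: +1 named fact, no proof owed in the tree — PREPRINT claim). Kernel
  consumers (Summits side, seat bsd-line-x2-p2 g3): `μ(X_ac^∅ strict at 𝔭̄) = 0` and `Λ`-torsion at
  every X2c Heegner datum, both signs (`Theorems/EisensteinPrimesBSDpOnCellCStubC3MultMuLemma.lean`,
  via `XAcImprimitiveLambdaShift`, p564629).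

## References
* [KellerYin2024] arXiv:2402.12781v2: §5 (L1718–L1722), §5.1 (L1725–L1735), Lemma 5.1.1 (L1744–L1749),
  §0.1 (L233–L235), §1.4 (L1063–L1098: `badextension`'s twin `char to f`, the no-global-torsion
  convention, lattice independence), Thm. 1.4.1 (L1087–L1098); arXiv v1 Lemma 5.0.2 (store text
  `paper:arxiv-2402.12781` p0023). PAGEMAP: `run/shared/lean/pub/bsd-eis/lit/src/ky24-v2/PAGEMAP-v2.md`.
* [Castella2018] Camb. J. Math. 6, §2.1 Def. 2.2 (arXiv:1704.06608 p. 5) — the object `X_ac^Σ`.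
* [CastellaGrossiLeeSkinner2022] Invent. Math. 227, §2.3 (`𝔛_E^S`), Thm. 1.5.1 proof (eq:lambda-imp).
* [GreenbergVatsal2000] Invent. Math. 142, §2 (the imprimitive devissage the printed proof rests on).
* Cell: `Literature/…/KellerYin2024/MultiplicativeReduction.lean` (Thm. D, flags `KYD-*`),
  `…/AnomalousImprimitiveLambdaInvariants.lean` (Thm. 1.4.1), bsd-littype FAITHFULNESS-05.md.
-/


noncomputable section

open scoped Classical

open WeierstrassCurve NumberField IsDedekindDomain Field
  Literature.NumberTheory.EllipticCurves Literature.NumberTheory.QuadraticFields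
  Literature.NumberTheory.EllipticCurves.Rank1Residual Literature.NumberTheory.EllipticCurves.Castella2018
  Literature.NumberTheory.GaloisRepresentations

namespace Literature.NumberTheory.EllipticCurves.KellerYin2024

/-! ### §1 Lemma 5.1.1 (member `f`, weight 2): the OPEN fact -/

section Lemma511

/-- **OPEN HYPOTHESIS — UNREFEREED PREPRINT (Keller–Yin, arXiv:2402.12781v2, §5.1 Lemma 5.1.1, TeX
L1744–1749; arXiv v1 Lemma 5.0.2), the member-`f` half.** Verbatim: "The `μ`-invariants of `𝔛^S_f`
and `𝔛^S_{f_m}` are `0`." — printed proof: "This is essentially proved in Theorem 1.4.1 since the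
proof only relies on the extension `0 → 𝔽(φ) → ρ̄_f → 𝔽(ψ) → 0`. Note that the characters can be
arbitrary." Setting (§5, L1718–1722; §5.1, L1725–1735; §0.1, L233–L235): `f ∈ S_2(Γ_0(N))` a newform,
`p ≠ 2`, `ρ̄_f` reducible, `p ‖ N`; `K` a Heegner field for `N` with `D_K` odd, `≠ −3`, `p = v v̄`
split; `Λ = 𝒪⟦Gal(K_∞/K)⟧` anticyclotomic; `S = Σ ∖ {v, v̄, ∞}`, `Σ ⊇ {∞} ∪ {w ∣ N}` finite with split
finite places; `𝔛^S_f = H¹_{𝓕^S_nr}(K, M_f)^∨` (no condition at `w ∈ S` and at `v`, unramified at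
`v̄`). TRANSCRIBED for an elliptic curve `W/ℚ` (`f = f_W`, `𝒪 = ℤ_p`; module docstring for the
dictionary and the flags `KY511-S` / `KYD-Sel` / `KY511-tors` / `KY511-h1`): for `W/ℚ` globally
minimal, `2 < p`, `Mult W p`, `Red W p`; `K` imaginary quadratic with (Heeg) for `N_W`, (disc), (spl);
`vbar ∋ p`; `κ` anticyclotomic with topological generator `γ`; `Sf` = the places of `K` over `N_W`
not over `p` (KY's `S` at the minimal `Σ`): **`X^{Sf} := AcSelmer.XAc (W.baseChange K) p κ vbar ↑Sf γ`
is `Λ`-torsion and `muInvariant p X^{Sf} = 0`.** Only the member `f` (weight `2`) is transcribed; the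
Hida-family members `f_m` have no tree object. NEVER cite this `Prop` as a theorem: take it as an
explicit hypothesis; a result using it is conditional on an unrefereed claim.
[claim: KellerYin2024, status: under-review]
[cite: KellerYin2024, Lemma 5.1.1 (arXiv:2402.12781v2 §5.1 TeX L1744–1749), §5.1 (L1725–1735), §5 (L1718–1722), §0.1 (L233–235)]
[cite: Castella2018, Def. 2.2 (arXiv:1704.06608 p. 5) (the object `X_ac^Σ(E[p^∞])`; shape only, nothing asserted)]
[cite: CastellaGrossiLeeSkinner2022, §2.3 (arXiv:2008.02571v2 TeX L811–L857) (`𝔛_E^S`; shape only)] -/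
def lemma511_imprimitive_isTorsion_muInvariant_eq_zero_mult_OPEN : Prop :=
  ∀ {p : ℕ} [Fact p.Prime] (W : WeierstrassCurve ℚ) [W.IsElliptic] [W.IsGloballyMinimal]
    (K : Type) [Field K] [NumberField K] (vbar : HeightOneSpectrum (𝓞 K))
    (κ : ZpExtension K p) (γ : absoluteGaloisGroup K) [Fact (κ.IsTopGenerator γ)]
    (Sf : Finset (HeightOneSpectrum (𝓞 K))),
    -- "`f ∈ S_2(Γ_0(N))` a newform [`f = f_W`, `N = N_W`] … `p ≠ 2` … `ρ̄_f` reducible … `p ‖ N`"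
    2 < p → Mult W p → Red W p →
    -- "`K` … satisfying the hypotheses in §0.1": Heegner field for `N`, `D_K` odd `≠ −3`, `p` split
    IsImaginaryQuadratic K → SatisfiesHeegnerHypothesis (W.conductorNorm ℤ) K →
      Odd (NumberField.discr K) → NumberField.discr K ≠ -3 →
      ((Ideal.span {(p : ℤ)}).primesOver (𝓞 K)).ncard = 2 →
    -- `p = v v̄`: `𝔛^S_f` unramified (tree: strict) at `v̄`, relaxed at the other prime `v`
    ((p : ℕ) : 𝓞 K) ∈ vbar.asIdeal →
    -- `Λ = ℤ_p[[Γ]]`, `Γ = Gal(K_∞/K)` THE anticyclotomic `ℤ_p`-extension, `γ` a topological generator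
    κ.IsAnticyclotomic →
    -- `S = Σ ∖ {v, v̄, ∞}` at `Σ = {∞} ∪ {w ∣ N}`: the places of `K` over `N_W` not over `p`
    (∀ w : HeightOneSpectrum (𝓞 K), w ∈ Sf ↔
      (((W.conductorNorm ℤ : ℤ) : 𝓞 K) ∈ w.asIdeal ∧ ((p : ℕ) : 𝓞 K) ∉ w.asIdeal)) →
    Module.IsTorsion (IwasawaAlgebra p)
        (AcSelmer.XAc (W.baseChange K) p κ vbar (↑Sf : Set (HeightOneSpectrum (𝓞 K))) γ) ∧
      muInvariant p (AcSelmer.XAc (W.baseChange K) p κ vbar (↑Sf : Set (HeightOneSpectrum (𝓞 K))) γ) = 0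

end Lemma511

end Literature.NumberTheory.EllipticCurves.KellerYin2024

end
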